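import Literature.MathematicalPhysics.QuantumFieldTheory.Balaban1983to89.B4ThmRegionPairEta
import Literature.MathematicalPhysics.QuantumFieldTheory.Balaban1983to89.B4Lemma22ReduceDeriv

/-!
# `Balaban1983to89.B4Thm19ShortestContour` — [Balaban1983RegularityDecay] THEOREM p. 573, the HÖLDER members (1.9) and
# (1.11)–(1.12) ON THE GENERAL-REGION-PAIR FAMILY with the left side READ AT EVERY SHORTEST LATTICE CONTOUR `Γ_{x,x′}`

statement-level skeleton of published theorems with citation tags; proofs where landed; nothing here is a claim about the Yang–Mills mass gap

CITATION HEADER.  T. Bałaban, *Regularity and decay of lattice Green's functions*, Commun. Math. Phys. **89** (1983)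
571–597 [Balaban1983RegularityDecay] (cell paper B4; held text `paper:balaban1983-cmp89-regularity-decay`, journal page =
PDF page + 570; p. 573 Theorem (1.9)–(1.12)).  Unit `lit-balaban-r04` gen 10 (SECOND READER of block B4; HOME
`run/shared/lean/pub/lit-balaban/`), SKELETON row **B4.Thm@573** — a RIDER on the row owner r01 gen 8's
`B4ThmRegionPairEta` (the typed `η`-uniform Theorem `ThmPrintedNN` INHABITED on the family `regionPairFam` of general
pairs `Ω ⊂ Ω₀` of finite unions of big blocks at a (1.7)-regular field, printed restriction `dist(·, Ωᶜ) ≥ R₀` live).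

WHAT IS PRINTED (p. 573).  «… |x − x′|^{−α}|U(A(Γ_{x,x′}))(D^η_{A,μ}G_k(Ω,A)f)(x′) − (D^η_{A,μ}G_k(Ω,A)f)(x)| ≤
c₀ exp(−δ₀ dist({x,x′}, supp f))‖f‖_∞ (1.9) for x, x′ ∈ Ω, and satisfying the condition dist({x,x′}, Ωᶜ) ≥ R₀. Here
Γ_{x,x′} denotes a shortest contour connecting the points x, x′.»  and the δG clause «(1.9) … (with the same restrictions
on x, x′) with the additional factor (1.12)».

WHY THIS FILE (second-reader pass 21, located qualifier (q15), `lit-balaban-r04/SECOND-READ-B4.md` §17).  In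
`regionPairFam` the left side of (1.9) is `holderQ` = the supremum over the ADMISSIBLE contours `Adm` — nearest-neighbour
chains OF `Ω` from `x` to `x′` of length `≤ (d+1)|x′−x|_∞` inside the `|x′−x|_∞`-ball about `x` — and is `0` (vacuous)
at pairs without such a contour.  Print's `Γ_{x,x′}` is «a shortest contour connecting the points x, x′», a lattice
geodesic which for distant points of a non-convex `Ω` may leave `Ω` (the vector field `A` lives on all bonds of the
lattice, p. 572).  THIS MODULE PROVES, from `thmPrintedNN_regionPairFam` and lattice geometry ONLY, both Hölder members
WITH THE LEFT SIDE TAKEN AT EVERY SHORTEST LATTICE CONTOUR `Γ` from `x` to `x′` — `U(A(Γ)) = U(κΣ_{b⊂Γ}A_b)` read on the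
whole-lattice component field — at every pair with `dist({x,x′}, Ωᶜ) ≥ R₀`, with constants `(δ₀, 2c₀, max(R₀,1), e₁)`:
no admissibility proviso is left.  MECHANISM: (close pairs, `|x′−x|_∞ < n·R₀`) an `ℓ¹`-geodesic stays in the coordinate
box of its end points (`geodesic_between`), hence in the `|x′−x|_∞`-ball about `x` (`geodesic_supNorm_le`), hence
inside `Ω` (`RegionPairInst.cdist_mul_le`), and lifts to an admissible `Ω`-chain (`liftChain`, `adm_liftChain`), so
`holderQ` dominates it (`le_holderQ`); (far pairs) the weight `(n/|x′−x|_∞)^α ≤ 1` and `U(A(Γ))` is orthogonal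
(`transport_fieldLink`, `siteNorm_flow`), so the (1.10) / (1.12) derivative members at `x` and at `x′` bound the left
side for ANY contour (`core_bound`).

WHAT THIS MODULE PROVES (all in full).
* §1 `IsLatChain`, `l1` (the `ℓ¹` distance on `ℤ^{d+1}`): `l1_le_length` (a nearest-neighbour chain from `x` to `x′` has
  `≥ ‖x′−x‖₁` steps), `geodesic_between` (every site of a chain of EXACTLY `‖x′−x‖₁` steps lies coordinatewise between
  `x` and `x′`), `geodesic_supNorm_le`, `l1_le_mul_supNorm` (`‖v‖₁ ≤ (d+1)‖v‖_∞`).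
* §2 `liftChain` (a lattice chain inside `Ω` as a chain of sites of `Ω`) with `pathSum_liftChain` (+ private length/membership/chain/end lemmas).
* §3 on r01's `RegionPairInst`: `bond_mem_of_cdist` (the guard `dist(x,Ωᶜ) ≥ 1` puts the bonds at `x` inside `Ω`),
  `le_holderQ` (every admissible contour is dominated by `holderQ`), `adm_liftChain`, **`core_bound`** (the dichotomy).
* §4 **`thm19_shortestContour_regionPairFam`**: `∀ α ∈ [0,1) ∃ δ₀ c₀ R₀ e₁ > 0 ∀ i` (regular, bigBlocks, `0 < e ≤ e₁`)
  `∀ μ f x x′ ∀ Γ` shortest lattice contour from `x` to `x′`, `dist({x,x′},Ωᶜ) ≥ R₀ ⟹`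
  `|x−x′|^{−α}|U(A(Γ))(D_μG_kf)(x′) − (D_μG_kf)(x)| ≤ c₀e^{−δ₀dist({x,x′},supp f)}‖f‖_∞` AND the same for `δG_kf` with the
  factor (1.12) `e^{−(δ₀dist({x,x′},Ωᶜ) + δ₀dist(supp f,Ωᶜ))}` — on `regionPairFam … Kmod`, from `thmPrintedNN_regionPairFam`.
HONEST SCOPE.  Exactly the setting and readings of `B4ThmRegionPairEta` (abelian one-parameter orthogonal flow, component
field on the whole lattice, `a_k` running in the window, `m² ∈ [0,m²₊]`, `ℓ^∞` unit-lattice distances, `supN`, `0 ≤ α < 1`,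
(1.7) on `Ω₀`, `K = Kmod` before `α`); «shortest contour» = nearest-neighbour chain in `ℤ^{d+1}` with `‖x′−x‖₁` steps (every
`ℓ¹`-geodesic; print does not fix one); the new `R₀` is `max(R₀,1)` and the new `c₀` is `2c₀` of `thmPrintedNN_regionPairFam`.
No `sorry`; no new `Prop` fact; axioms standard.
-/

namespace Literature.MathematicalPhysics.QuantumFieldTheory.Balaban1983to89.B4Thm19ShortestContour

open Literature.MathematicalPhysics.QuantumFieldTheory.Balaban1983to89.B4 (EtaSetting Ineq19_110 Ineq111_112)
open Literature.MathematicalPhysics.QuantumFieldTheory.Balaban1983to89.B4Ineq111ZeroNestEta (ThmPrintedNN)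
open Literature.MathematicalPhysics.QuantumFieldTheory.Balaban1983to89.B4Reflection242 (nbrs mem_nbrs)
open Literature.MathematicalPhysics.QuantumFieldTheory.Balaban1983to89.B4GaugeCovariance
open Literature.MathematicalPhysics.QuantumFieldTheory.Balaban1983to89.B4ContourShift (supNorm supNorm_nonneg
  exists_supNorm_eq abs_le_supNorm)
open Literature.MathematicalPhysics.QuantumFieldTheory.Balaban1983to89.B4Lower18 (fineDom mem_fineDom IsBlockUnion)
open Literature.MathematicalPhysics.QuantumFieldTheory.Balaban1983to89.B4Lower18Regular (e1)
open Literature.MathematicalPhysics.QuantumFieldTheory.Balaban1983to89.B4Lower18RegularRegion (compField)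
open Literature.MathematicalPhysics.QuantumFieldTheory.Balaban1983to89.B4Lemma21Region (siteNorm)
open Literature.MathematicalPhysics.QuantumFieldTheory.Balaban1983to89.B4Lemma22Reduce231 (supN supN_nonneg
  siteNorm_nonneg siteNorm_zero)
open Literature.MathematicalPhysics.QuantumFieldTheory.Balaban1983to89.B4Lemma22HolderBox (IsNNChain pathSum
  transport_fieldLink siteNorm_sub_le)
open Literature.MathematicalPhysics.QuantumFieldTheory.Balaban1983to89.B4Lemma22ReduceDeriv (siteNorm_flow)
open Literature.MathematicalPhysics.QuantumFieldTheory.Balaban1983to89.B4Eq221L2FactorRegion (acBond)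
open Literature.MathematicalPhysics.QuantumFieldTheory.Balaban1983to89.B4ThmRegionPairEta (RegionPairInst regionPairFam
  Kmod thmPrintedNN_regionPairFam)
open scoped Matrix

noncomputable section

/-! ## §1. Lattice chains, the `ℓ¹` distance, and shortest contours -/

section Lattice

variable {d : ℕ}

/-- a NEAREST-NEIGHBOUR CHAIN in the lattice `ℤ^{d+1}`: consecutive sites of the contour `x, l₀, l₁, …` are lattice
neighbours. [cite: Balaban1983RegularityDecay, p.573 «Γ_{x,x′} denotes a shortest contour connecting the points x, x′», dictionary] -/
def IsLatChain : (Fin (d + 1) → ℤ) → List (Fin (d + 1) → ℤ) → Prop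
  | _, [] => True
  | x, y :: l => y ∈ nbrs x ∧ IsLatChain y l

/-- the `ℓ¹` (graph) distance `‖x′ − x‖₁ = Σ_ν |x′_ν − x_ν|` on `ℤ^{d+1}` — the length of a shortest contour.
[cite: Balaban1983RegularityDecay, p.573 «a shortest contour», dictionary] -/
def l1 (x x' : Fin (d + 1) → ℤ) : ℤ := ∑ ν, |x' ν - x ν|

/-- `‖x − x‖₁ = 0`. [folklore] -/
private theorem l1_self (x : Fin (d + 1) → ℤ) : l1 x x = 0 := by simp [l1]

/-- `‖·‖₁ ≥ 0`. [folklore] -/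
private theorem l1_nonneg (x x' : Fin (d + 1) → ℤ) : 0 ≤ l1 x x' := Finset.sum_nonneg fun _ _ => abs_nonneg _

/-- the `ℓ¹` distance split at a coordinate. [folklore] -/
private theorem l1_split (x x' : Fin (d + 1) → ℤ) (i : Fin (d + 1)) :
    l1 x x' = |x' i - x i| + ∑ ν ∈ Finset.univ.erase i, |x' ν - x ν| := by
  unfold l1
  exact (Finset.add_sum_erase _ _ (Finset.mem_univ i)).symm

/-- a lattice neighbour `y = x ± e_i`: the shifted coordinate and the others. [folklore] -/
private theorem nbr_coords {x y : Fin (d + 1) → ℤ} (hy : y ∈ nbrs x) :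
    ∃ i : Fin (d + 1), (y i = x i + 1 ∨ y i = x i - 1) ∧ ∀ ν, ν ≠ i → y ν = x ν := by
  obtain ⟨i, hi⟩ := mem_nbrs.1 hy
  refine ⟨i, ?_, fun ν hν => ?_⟩
  · rcases hi with h | h
    · left; rw [h]; simp
    · right; rw [h]; simp
  · rcases hi with h | h
    · rw [h]; simp [hν]
    · rw [h]; simp [hν]

/-- one step changes the `ℓ¹` distance to any point by at most one: `‖x′−x‖₁ ≤ ‖x′−y‖₁ + 1` for `y` a neighbour
of `x`. [folklore] -/
private theorem l1_le_nbr_add_one {x y : Fin (d + 1) → ℤ} (hy : y ∈ nbrs x) (x' : Fin (d + 1) → ℤ) :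
    l1 x x' ≤ l1 y x' + 1 := by
  obtain ⟨i, hi, hrest⟩ := nbr_coords hy
  rw [l1_split x x' i, l1_split y x' i]
  have hsum : ∑ ν ∈ Finset.univ.erase i, |x' ν - y ν| = ∑ ν ∈ Finset.univ.erase i, |x' ν - x ν| :=
    Finset.sum_congr rfl fun ν hν => by rw [hrest ν (Finset.ne_of_mem_erase hν)]
  rw [hsum]
  have h1 : |x' i - x i| ≤ |x' i - y i| + 1 := by
    rcases hi with h | h <;> rw [h] <;>
      rcases abs_cases (x' i - x i) with ⟨h1, _⟩ | ⟨h1, _⟩ <;>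
      rcases abs_cases (x' i - (x i + 1)) with ⟨h2, _⟩ | ⟨h2, _⟩ <;>
      rcases abs_cases (x' i - (x i - 1)) with ⟨h3, _⟩ | ⟨h3, _⟩ <;> omega
  linarith

/-- a nearest-neighbour chain from `x` to `x′` has at least `‖x′ − x‖₁` steps — `‖x′ − x‖₁` IS the length of a shortest
contour. [cite: Balaban1983RegularityDecay, p.573 «a shortest contour connecting the points x, x′», dictionary] -/
theorem l1_le_length {x : Fin (d + 1) → ℤ} {l : List (Fin (d + 1) → ℤ)} (hl : IsLatChain x l) :
    l1 x (pathEnd x l) ≤ l.length := by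
  induction l generalizing x with
  | nil => simp [pathEnd, l1_self]
  | cons y l ih =>
      obtain ⟨hy, hl'⟩ := hl
      simp only [pathEnd, List.length_cons, Nat.cast_add, Nat.cast_one]
      exact (l1_le_nbr_add_one hy _).trans (by linarith [ih hl'])

/-- a step that brings the `ℓ¹` distance to `x′` down by one moves its coordinate TOWARDS `x′`. [folklore] -/
private theorem nbr_between {x y x' : Fin (d + 1) → ℤ} (hy : y ∈ nbrs x) (hd : l1 y x' = l1 x x' - 1) (ν : Fin (d + 1)) :
    min (x ν) (x' ν) ≤ y ν ∧ y ν ≤ max (x ν) (x' ν) := by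
  obtain ⟨i, hi, hrest⟩ := nbr_coords hy
  by_cases hν : ν = i
  · subst hν
    rw [l1_split x x' ν, l1_split y x' ν] at hd
    have hsum : ∑ μ ∈ Finset.univ.erase ν, |x' μ - y μ| = ∑ μ ∈ Finset.univ.erase ν, |x' μ - x μ| :=
      Finset.sum_congr rfl fun μ hμ => by rw [hrest μ (Finset.ne_of_mem_erase hμ)]
    rw [hsum] at hd
    have hd' : |x' ν - y ν| = |x' ν - x ν| - 1 := by linarith
    rcases hi with h | h <;> rw [h] at hd' ⊢ <;>
      rcases abs_cases (x' ν - x ν) with ⟨h1, _⟩ | ⟨h1, _⟩ <;>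
      rcases abs_cases (x' ν - (x ν + 1)) with ⟨h2, _⟩ | ⟨h2, _⟩ <;>
      rcases abs_cases (x' ν - (x ν - 1)) with ⟨h3, _⟩ | ⟨h3, _⟩ <;>
      simp only [min_le_iff, le_max_iff] <;> omega
  · rw [hrest ν hν]
    exact ⟨min_le_left _ _, le_max_left _ _⟩

/-- **AN `ℓ¹`-GEODESIC STAYS IN THE COORDINATE BOX OF ITS END POINTS**: on a nearest-neighbour chain from `x` to `x′`
with EXACTLY `‖x′ − x‖₁` steps (a shortest contour) every site lies coordinatewise between `x` and `x′`.
[cite: Balaban1983RegularityDecay, p.573 «a shortest contour connecting the points x, x′», dictionary] -/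
theorem geodesic_between {x : Fin (d + 1) → ℤ} {l : List (Fin (d + 1) → ℤ)} (hl : IsLatChain x l)
    (hlen : (l.length : ℤ) = l1 x (pathEnd x l)) :
    ∀ w ∈ l, ∀ ν, min (x ν) (pathEnd x l ν) ≤ w ν ∧ w ν ≤ max (x ν) (pathEnd x l ν) := by
  induction l generalizing x with
  | nil => intro w hw; simp at hw
  | cons y l ih =>
      obtain ⟨hy, hl'⟩ := hl
      simp only [pathEnd, List.length_cons, Nat.cast_add, Nat.cast_one] at hlen ⊢
      -- the step `x → y` decreases the distance to the end point by exactly one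
      have h1 : l1 y (pathEnd y l) ≤ l.length := l1_le_length hl'
      have h2 : l1 x (pathEnd y l) ≤ l1 y (pathEnd y l) + 1 := l1_le_nbr_add_one hy _
      have hd : l1 y (pathEnd y l) = l1 x (pathEnd y l) - 1 := by linarith
      have hlen' : (l.length : ℤ) = l1 y (pathEnd y l) := by linarith
      have hstep := nbr_between hy hd
      intro w hw ν
      rcases List.mem_cons.1 hw with rfl | hw'
      · exact hstep ν
      · obtain ⟨ha, hb⟩ := ih hl' hlen' w hw' ν
        obtain ⟨hc, hd'⟩ := hstep ν
        simp only [min_def, max_def] at ha hb hc hd' ⊢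
        constructor <;> split_ifs at * <;> omega

/-- hence every site of a shortest contour is within `|x′ − x|_∞` of `x` (sup norm).
[cite: Balaban1983RegularityDecay, p.573 «a shortest contour connecting the points x, x′», dictionary] -/
theorem geodesic_supNorm_le {x : Fin (d + 1) → ℤ} {l : List (Fin (d + 1) → ℤ)} (hl : IsLatChain x l)
    (hlen : (l.length : ℤ) = l1 x (pathEnd x l)) {w : Fin (d + 1) → ℤ} (hw : w ∈ l) :
    supNorm (w - x) ≤ supNorm (pathEnd x l - x) := by
  unfold supNorm
  refine Finset.sup'_le _ _ fun ν _ => le_trans ?_ (abs_le_supNorm (pathEnd x l - x) ν)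
  rw [Pi.sub_apply, Pi.sub_apply, Int.cast_le]
  obtain ⟨ha, hb⟩ := geodesic_between hl hlen w hw ν
  simp only [min_le_iff, le_max_iff] at ha hb
  rcases abs_cases (w ν - x ν) with ⟨h1, _⟩ | ⟨h1, _⟩ <;>
    rcases abs_cases (pathEnd x l ν - x ν) with ⟨h2, _⟩ | ⟨h2, _⟩ <;> omega

/-- `‖v‖₁ ≤ (d+1)‖v‖_∞` on `ℤ^{d+1}`: a shortest contour has at most `(d+1)|x′−x|_∞` steps (the length bound of `Adm`).
[cite: Balaban1983RegularityDecay, p.573 «a shortest contour connecting the points x, x′», dictionary] -/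
theorem l1_le_mul_supNorm (x x' : Fin (d + 1) → ℤ) : ((l1 x x' : ℤ) : ℝ) ≤ ((d : ℝ) + 1) * supNorm (x' - x) := by
  unfold l1
  rw [Int.cast_sum]
  calc ∑ ν, ((|x' ν - x ν| : ℤ) : ℝ) ≤ ∑ _ν : Fin (d + 1), supNorm (x' - x) :=
        Finset.sum_le_sum fun ν _ => by
          have := abs_le_supNorm (x' - x) ν
          rwa [Pi.sub_apply] at this
    _ = ((d : ℝ) + 1) * supNorm (x' - x) := by
        rw [Finset.sum_const, Finset.card_univ, Fintype.card_fin, nsmul_eq_mul]; push_cast; ring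

/-- `supNorm (−v) = supNorm v`. [folklore] -/
private theorem supNorm_neg' (v : Fin (d + 1) → ℤ) : supNorm (-v) = supNorm v := by
  unfold supNorm; congr 1; funext ν; rw [Pi.neg_apply, abs_neg]

/-- `supNorm (a − b) = supNorm (b − a)`. [folklore] -/
private theorem supNorm_sub_comm' (a b : Fin (d + 1) → ℤ) : supNorm (a - b) = supNorm (b - a) := by
  rw [← supNorm_neg', neg_sub]

/-- `supNorm e_μ ≤ 1`. [folklore] -/
private theorem supNorm_e1_le (μ : Fin (d + 1)) : supNorm (e1 μ : Fin (d + 1) → ℤ) ≤ 1 := by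
  unfold supNorm
  refine Finset.sup'_le _ _ fun ν _ => ?_
  by_cases h : ν = μ
  · subst h; simp [e1]
  · simp [e1, h]

end Lattice

/-! ## §2. A lattice chain inside `Ω` as a chain of sites of `Ω` -/

section Lift

variable {d : ℕ} {n : ℕ} {Ωc : Finset (Fin (d + 1) → ℤ)}

/-- the lattice chain `Γ`, all of whose sites lie in the fine region, as a list of sites OF the region.
[cite: Balaban1983RegularityDecay, p.573 «Γ_{x,x′}», dictionary] -/
def liftChain : (Γ : List (Fin (d + 1) → ℤ)) → (∀ z ∈ Γ, z ∈ fineDom n Ωc) → List ↥(fineDom n Ωc)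
  | [], _ => []
  | z :: Γ, h => ⟨z, h z (by simp)⟩ :: liftChain Γ (fun w hw => h w (by simp [hw]))

/-- the lift has the same length. [folklore] -/
private theorem length_liftChain : ∀ (Γ : List (Fin (d + 1) → ℤ)) (h : ∀ z ∈ Γ, z ∈ fineDom n Ωc),
    (liftChain Γ h).length = Γ.length
  | [], _ => rfl
  | _ :: Γ, h => by simp only [liftChain, List.length_cons, length_liftChain Γ]

/-- the sites of the lift are the sites of `Γ`. [folklore] -/
private theorem mem_liftChain : ∀ (Γ : List (Fin (d + 1) → ℤ)) (h : ∀ z ∈ Γ, z ∈ fineDom n Ωc)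
    (w : ↥(fineDom n Ωc)), w ∈ liftChain Γ h → w.1 ∈ Γ
  | [], _, w, hw => by simp [liftChain] at hw
  | z :: Γ, h, w, hw => by
      simp only [liftChain, List.mem_cons] at hw
      rcases hw with rfl | hw
      · simp
      · exact List.mem_cons_of_mem _ (mem_liftChain Γ _ w hw)

/-- the lift of a lattice chain is a nearest-neighbour chain of the region. [folklore] -/
private theorem isNNChain_liftChain : ∀ (Γ : List (Fin (d + 1) → ℤ)) (h : ∀ z ∈ Γ, z ∈ fineDom n Ωc)
    (x : ↥(fineDom n Ωc)), IsLatChain x.1 Γ → IsNNChain x (liftChain Γ h)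
  | [], _, _, _ => by simp [liftChain, IsNNChain]
  | z :: Γ, h, x, hΓ => by
      obtain ⟨hz, hΓ'⟩ := hΓ
      simp only [liftChain, IsNNChain]
      exact ⟨hz, isNNChain_liftChain Γ _ ⟨z, h z (by simp)⟩ hΓ'⟩

/-- the lift ends where `Γ` ends. [folklore] -/
private theorem pathEnd_liftChain : ∀ (Γ : List (Fin (d + 1) → ℤ)) (h : ∀ z ∈ Γ, z ∈ fineDom n Ωc)
    (x : ↥(fineDom n Ωc)), (pathEnd x (liftChain Γ h)).1 = pathEnd x.1 Γ
  | [], _, _ => rfl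
  | z :: Γ, h, x => by
      simp only [liftChain, pathEnd]
      exact pathEnd_liftChain Γ _ ⟨z, h z (by simp)⟩

/-- the bond sum `Σ_{b⊂Γ} A_b` of the region's bond function along the lift is the bond sum of the whole-lattice
component field along `Γ`. [cite: Balaban1983RegularityDecay, p.572 «A(Γ) = Σ_{b⊂Γ} A_b», dictionary] -/
theorem pathSum_liftChain (Ac : (Fin (d + 1) → ℤ) → Fin (d + 1) → ℝ) :
    ∀ (Γ : List (Fin (d + 1) → ℤ)) (h : ∀ z ∈ Γ, z ∈ fineDom n Ωc) (x : ↥(fineDom n Ωc)),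
    pathSum (acBond Ωc Ac) x (liftChain Γ h) = pathSum (compField Ac) x.1 Γ
  | [], _, _ => rfl
  | z :: Γ, h, x => by
      simp only [liftChain, pathSum]
      rw [pathSum_liftChain Ac Γ _ ⟨z, h z (by simp)⟩]

end Lift

/-! ## §3. On r01's instances: the guard, the domination by `holderQ`, the close/far dichotomy -/

section Core

variable {ι : Type} [Fintype ι] [DecidableEq ι]
variable {d ℓ : ℕ} {amin aplus m2plus : ℝ} (i : RegionPairInst d ℓ amin aplus m2plus) (F : OrthFlow ι)

omit [Fintype ι] [DecidableEq ι] in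
/-- `n = (ℓ+1)^k ≥ 2` for `ℓ ≥ 1`, `k ≥ 1`. [folklore] -/
private theorem two_le_n (hℓ : 1 ≤ ℓ) : (2 : ℝ) ≤ (((ℓ + 1) ^ i.k : ℕ) : ℝ) := by
  have h1 : ℓ + 1 ≤ (ℓ + 1) ^ i.k := Nat.le_self_pow (Nat.one_le_iff_ne_zero.mp i.hk) (ℓ + 1)
  have h2 : 2 ≤ ℓ + 1 := by omega
  exact_mod_cast h2.trans h1

omit [Fintype ι] [DecidableEq ι] in
/-- **the guard puts nearby lattice points inside `Ω`**: if `R ≤ dist(x, Ωᶜ)` (unit-lattice units) and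
`|w − x|_∞ < n·R` (fine units) then `w ∈ Ω`. [cite: Balaban1983RegularityDecay, Theorem p.573 «dist(x, Ωᶜ) ≥ R₀», dictionary] -/
theorem mem_of_supNorm_lt (x : ↥(fineDom ((ℓ + 1) ^ i.k) i.Ωc)) {R : ℝ} (hRx : R ≤ i.cdist x)
    {w : Fin (d + 1) → ℤ} (hw : supNorm (w - x.1) < (((ℓ + 1) ^ i.k : ℕ) : ℝ) * R) :
    w ∈ fineDom ((ℓ + 1) ^ i.k) i.Ωc := by
  by_contra hwΩ
  have h1 := i.cdist_mul_le x hwΩ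
  rw [supNorm_sub_comm'] at h1
  have hn : (0 : ℝ) ≤ (((ℓ + 1) ^ i.k : ℕ) : ℝ) := Nat.cast_nonneg _
  have h2 : (((ℓ + 1) ^ i.k : ℕ) : ℝ) * R ≤ i.cdist x * (((ℓ + 1) ^ i.k : ℕ) : ℝ) := by
    rw [mul_comm]; exact mul_le_mul_of_nonneg_right hRx hn
  linarith

omit [Fintype ι] [DecidableEq ι] in
/-- **the guard `dist(x, Ωᶜ) ≥ 1` puts the bonds at `x` inside `Ω`** (`n ≥ 2`): `x + e_μ ∈ Ω`.
[cite: Balaban1983RegularityDecay, Theorem p.573 «dist(x, Ωᶜ) ≥ R₀», dictionary] -/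
theorem bond_mem_of_cdist (hℓ : 1 ≤ ℓ) (x : ↥(fineDom ((ℓ + 1) ^ i.k) i.Ωc)) {R : ℝ} (hR1 : 1 ≤ R)
    (hRx : R ≤ i.cdist x) (μ : Fin (d + 1)) : x.1 + e1 μ ∈ fineDom ((ℓ + 1) ^ i.k) i.Ωc := by
  refine mem_of_supNorm_lt i x hRx ?_
  rw [add_sub_cancel_left]
  have h2 := two_le_n i hℓ
  have h3 := supNorm_e1_le (d := d) μ
  nlinarith

/-- the Hölder weight is nonnegative. [cite: Balaban1983RegularityDecay, (1.9) p.573, dictionary] -/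
theorem wt_nonneg (α : ℝ) (x x' : ↥(fineDom ((ℓ + 1) ^ i.k) i.Ωc)) : 0 ≤ i.wt α x x' :=
  Real.rpow_nonneg (div_nonneg (Nat.cast_nonneg _) (supNorm_nonneg _)) α

/-- **every admissible contour is dominated by `holderQ`** (the supremum is over a bounded family: the transports are
orthogonal). [cite: Balaban1983RegularityDecay, (1.9) p.573, dictionary] -/
theorem le_holderQ {α : ℝ} {μ : Fin (d + 1)} (v : ↥(fineDom ((ℓ + 1) ^ i.k) i.Ωc) × ι → ℝ)
    {x x' : ↥(fineDom ((ℓ + 1) ^ i.k) i.Ωc)} {l : List ↥(fineDom ((ℓ + 1) ^ i.k) i.Ωc)} (hl : i.Adm μ x x' l) :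
    i.wt α x x' * siteNorm (transport (fieldLink F i.κ (acBond i.Ωc i.Ac)) x l *ᵥ fld v x' - fld v x)
      ≤ i.holderQ F α μ v x x' := by
  set B : ℝ := i.wt α x x' * (siteNorm (fld v x') + siteNorm (fld v x)) with hB
  have hbdd : ∀ l' : List ↥(fineDom ((ℓ + 1) ^ i.k) i.Ωc),
      i.wt α x x' * siteNorm (transport (fieldLink F i.κ (acBond i.Ωc i.Ac)) x l' *ᵥ fld v x' - fld v x) ≤ B := by
    intro l'
    refine mul_le_mul_of_nonneg_left ?_ (wt_nonneg i α x x')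
    calc siteNorm (transport (fieldLink F i.κ (acBond i.Ωc i.Ac)) x l' *ᵥ fld v x' - fld v x)
        ≤ siteNorm (transport (fieldLink F i.κ (acBond i.Ωc i.Ac)) x l' *ᵥ fld v x') + siteNorm (fld v x) :=
          siteNorm_sub_le _ _
      _ = siteNorm (fld v x') + siteNorm (fld v x) := by rw [transport_fieldLink, siteNorm_flow]
  have hB0 : 0 ≤ B := mul_nonneg (wt_nonneg i α x x') (add_nonneg (siteNorm_nonneg _) (siteNorm_nonneg _))
  have hrange : BddAbove (Set.range fun l' : List ↥(fineDom ((ℓ + 1) ^ i.k) i.Ωc) =>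
      ⨆ (_ : i.Adm μ x x' l'),
        i.wt α x x' * siteNorm (transport (fieldLink F i.κ (acBond i.Ωc i.Ac)) x l' *ᵥ fld v x' - fld v x)) := by
    refine ⟨B, ?_⟩
    rintro _ ⟨l', rfl⟩
    exact Real.iSup_le (fun _ => hbdd l') hB0
  unfold RegionPairInst.holderQ
  calc i.wt α x x' * siteNorm (transport (fieldLink F i.κ (acBond i.Ωc i.Ac)) x l *ᵥ fld v x' - fld v x)
      = ⨆ (_ : i.Adm μ x x' l),
          i.wt α x x' * siteNorm (transport (fieldLink F i.κ (acBond i.Ωc i.Ac)) x l *ᵥ fld v x' - fld v x) := by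
        rw [ciSup_pos hl]
    _ ≤ ⨆ (l' : List ↥(fineDom ((ℓ + 1) ^ i.k) i.Ωc)), ⨆ (_ : i.Adm μ x x' l'),
          i.wt α x x' * siteNorm (transport (fieldLink F i.κ (acBond i.Ωc i.Ac)) x l' *ᵥ fld v x' - fld v x) :=
        le_ciSup hrange l

omit [Fintype ι] [DecidableEq ι] in
/-- **a shortest lattice contour between CLOSE guarded points is admissible**: if `1 ≤ R ≤ dist(x, Ωᶜ), dist(x′, Ωᶜ)`,
`x′ ≠ x`, `|x′ − x|_∞ < n·R`, and `Γ` is a nearest-neighbour lattice chain from `x` to `x′` with `‖x′−x‖₁` steps, then all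
of `Γ` lies in `Ω` and its lift is an admissible contour `Adm μ x x′`. [cite: Balaban1983RegularityDecay, p.573 «Γ_{x,x′} denotes a shortest contour», dictionary] -/
theorem adm_liftChain (hℓ : 1 ≤ ℓ) {μ : Fin (d + 1)} {x x' : ↥(fineDom ((ℓ + 1) ^ i.k) i.Ωc)}
    {Γ : List (Fin (d + 1) → ℤ)} (hΓ : IsLatChain x.1 Γ) (hend : pathEnd x.1 Γ = x'.1)
    (hlen : (Γ.length : ℤ) = l1 x.1 x'.1) {R : ℝ} (hR1 : 1 ≤ R) (hRx : R ≤ i.cdist x) (hRx' : R ≤ i.cdist x')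
    (hne : x'.1 ≠ x.1) (hclose : supNorm (x'.1 - x.1) < (((ℓ + 1) ^ i.k : ℕ) : ℝ) * R) :
    ∃ hΓΩ : ∀ z ∈ Γ, z ∈ fineDom ((ℓ + 1) ^ i.k) i.Ωc, i.Adm μ x x' (liftChain Γ hΓΩ) := by
  have hlen' : (Γ.length : ℤ) = l1 x.1 (pathEnd x.1 Γ) := by rw [hend]; exact hlen
  have hball : ∀ w ∈ Γ, supNorm (w - x.1) ≤ supNorm (x'.1 - x.1) := fun w hw => by
    have := geodesic_supNorm_le hΓ hlen' hw
    rwa [hend] at this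
  have hΓΩ : ∀ z ∈ Γ, z ∈ fineDom ((ℓ + 1) ^ i.k) i.Ωc := fun z hz =>
    mem_of_supNorm_lt i x hRx ((hball z hz).trans_lt hclose)
  refine ⟨hΓΩ, bond_mem_of_cdist i hℓ x hR1 hRx μ, bond_mem_of_cdist i hℓ x' hR1 hRx' μ, hne,
    isNNChain_liftChain Γ hΓΩ x hΓ, Subtype.ext ((pathEnd_liftChain Γ hΓΩ x).trans hend), ?_, ?_⟩
  · rw [length_liftChain]
    have h1 : ((Γ.length : ℕ) : ℝ) = ((l1 x.1 x'.1 : ℤ) : ℝ) := by exact_mod_cast hlen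
    rw [h1]
    exact l1_le_mul_supNorm x.1 x'.1
  · intro z hz
    exact hball z.1 (mem_liftChain Γ hΓΩ z hz)

/-- **THE DICHOTOMY** behind reading (1.9) at a shortest LATTICE contour.  Data: a field `v` on `Ω` (it will be
`D_μG_kf` or `D_μδG_kf`), guarded points `1 ≤ R ≤ dist(x,Ωᶜ), dist(x′,Ωᶜ)`, a shortest lattice contour `Γ` from `x` to
`x′`, a bound `B` on `holderQ v x x′` and pointwise bounds `|v(x)|, |v(x′)| ≤ B`.  Then
`|x−x′|^{−α}|U(A(Γ))v(x′) − v(x)| ≤ 2B`: for `|x′−x|_∞ < nR` the contour is admissible (`adm_liftChain`) and `holderQ`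
dominates it (`le_holderQ`), the transport along the lift being `U(κΣ_{b⊂Γ}A_b)` (`transport_fieldLink`,
`pathSum_liftChain`); for `|x′−x|_∞ ≥ nR ≥ n` the weight is `≤ 1` and `U(A(Γ))` is orthogonal (`siteNorm_flow`).
[cite: Balaban1983RegularityDecay, Theorem (1.9) p.573] -/
theorem core_bound (hℓ : 1 ≤ ℓ) {α : ℝ} (hα0 : 0 ≤ α) {μ : Fin (d + 1)}
    (v : ↥(fineDom ((ℓ + 1) ^ i.k) i.Ωc) × ι → ℝ) {x x' : ↥(fineDom ((ℓ + 1) ^ i.k) i.Ωc)}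
    {Γ : List (Fin (d + 1) → ℤ)} (hΓ : IsLatChain x.1 Γ) (hend : pathEnd x.1 Γ = x'.1)
    (hlen : (Γ.length : ℤ) = l1 x.1 x'.1) {R : ℝ} (hR1 : 1 ≤ R) (hRx : R ≤ i.cdist x) (hRx' : R ≤ i.cdist x')
    {B : ℝ} (hB : 0 ≤ B) (hQ : i.holderQ F α μ v x x' ≤ B) (hvx : siteNorm (fld v x) ≤ B)
    (hvx' : siteNorm (fld v x') ≤ B) :
    i.wt α x x' * siteNorm (F.U (i.κ * pathSum (compField i.Ac) x.1 Γ) *ᵥ fld v x' - fld v x) ≤ 2 * B := by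
  have hn2 := two_le_n i hℓ
  have hnpos : (0 : ℝ) < (((ℓ + 1) ^ i.k : ℕ) : ℝ) := by linarith
  by_cases hxx : x'.1 = x.1
  · -- `x′ = x`: the contour is empty and the left side vanishes
    have hl0 : Γ.length = 0 := by
      have : (Γ.length : ℤ) = 0 := by rw [hlen, hxx, l1_self]
      exact_mod_cast this
    have hΓ0 : Γ = [] := List.eq_nil_of_length_eq_zero hl0
    have hx : x' = x := Subtype.ext hxx
    subst hΓ0
    rw [hx]
    simp only [pathSum, mul_zero, F.map_zero, Matrix.one_mulVec, sub_self, siteNorm_zero, mul_zero]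
    linarith
  by_cases hclose : supNorm (x'.1 - x.1) < (((ℓ + 1) ^ i.k : ℕ) : ℝ) * R
  · -- close points: the shortest contour is admissible and `holderQ` dominates it
    obtain ⟨hΓΩ, hadm⟩ := adm_liftChain i hℓ (μ := μ) hΓ hend hlen hR1 hRx hRx' hxx hclose
    have h1 := le_holderQ i F (α := α) v hadm
    rw [transport_fieldLink, pathSum_liftChain] at h1
    linarith [h1.trans hQ]
  · -- far points: weight `≤ 1`, orthogonal transport, pointwise bounds
    push Not at hclose
    have hs0 : 0 < supNorm (x'.1 - x.1) := lt_of_lt_of_le (by nlinarith) hclose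
    have hwt : i.wt α x x' ≤ 1 := by
      unfold RegionPairInst.wt
      refine Real.rpow_le_one (div_nonneg hnpos.le (supNorm_nonneg _)) ?_ hα0
      rw [div_le_one hs0]
      nlinarith
    have hS : siteNorm (F.U (i.κ * pathSum (compField i.Ac) x.1 Γ) *ᵥ fld v x' - fld v x) ≤ B + B :=
      calc siteNorm (F.U (i.κ * pathSum (compField i.Ac) x.1 Γ) *ᵥ fld v x' - fld v x)
          ≤ siteNorm (F.U (i.κ * pathSum (compField i.Ac) x.1 Γ) *ᵥ fld v x') + siteNorm (fld v x) :=
            siteNorm_sub_le _ _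
        _ = siteNorm (fld v x') + siteNorm (fld v x) := by rw [siteNorm_flow]
        _ ≤ B + B := add_le_add hvx' hvx
    calc i.wt α x x' * siteNorm (F.U (i.κ * pathSum (compField i.Ac) x.1 Γ) *ᵥ fld v x' - fld v x)
        ≤ 1 * (B + B) := mul_le_mul hwt hS (siteNorm_nonneg _) zero_le_one
      _ = 2 * B := by ring

end Core

/-! ## §4. The Hölder members of the Theorem at every shortest lattice contour -/

section Main

variable {ι : Type} [Fintype ι] [DecidableEq ι]

/-- **THEOREM p. 573, (1.9) AND ITS δG FORM (1.11)–(1.12), WITH `Γ_{x,x′}` ANY SHORTEST LATTICE CONTOUR**, on the family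
of general pairs `Ω ⊂ Ω₀` of finite unions of big blocks at a (1.7)-regular field (`regionPairFam`, block size `Kmod`):
for every `0 ≤ α < 1` there are `δ₀, c₀, R₀, e₁ > 0` such that for every instance whose field is (1.7)-regular on `Ω₀`,
whose `Ω`, `Ω₀` are unions of `Kmod`-blocks and whose coupling is `0 < e ≤ e₁`: for all `μ`, `f : Ω → ℝ^N`, `x, x′ ∈ Ω`
with «dist({x,x′}, Ωᶜ) ≥ R₀» and EVERY nearest-neighbour lattice chain `Γ` from `x` to `x′` with `‖x′−x‖₁` steps («Γ_{x,x′}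
denotes a shortest contour connecting the points x, x′»),
`|x−x′|^{−α}|U(A(Γ))(D^η_{A,μ}G_k(Ω,A)f)(x′) − (D^η_{A,μ}G_k(Ω,A)f)(x)| ≤ c₀e^{−δ₀dist({x,x′},supp f)}‖f‖_∞` (1.9) and the
same for `δG_k(Ω,Ω₀,A)f` «with the additional factor» `e^{−(δ₀dist({x,x′},Ωᶜ) + δ₀dist(supp f,Ωᶜ))}` (1.12) — with
`U(A(Γ)) = U(κΣ_{b⊂Γ}A_b)` on the whole-lattice component field, `κ = eη`.  From `thmPrintedNN_regionPairFam` (constants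
`(δ₀, 2c₀, max(R₀,1), e₁)`) by `core_bound`. [cite: Balaban1983RegularityDecay, Theorem (1.9)–(1.12) p.573] -/
theorem thm19_shortestContour_regionPairFam (F : OrthFlow ι) {ℓ₁ : ℝ} (hℓ₁ : 0 ≤ ℓ₁)
    (hLip : ∀ t (v : ι → ℝ), ((F.U t - 1) *ᵥ v) ⬝ᵥ ((F.U t - 1) *ᵥ v) ≤ (ℓ₁ * t) ^ 2 * (v ⬝ᵥ v))
    (d ℓ : ℕ) (hℓ : 1 ≤ ℓ) (amin aplus m2plus : ℝ) (ha : 0 < amin) (creg β : ℝ) (hcreg : 0 ≤ creg)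
    (hβ : 0 < β) :
    ∀ α : ℝ, 0 ≤ α → α < 1 → ∃ δ₀ c₀ R₀ e₁ : ℝ, 0 < δ₀ ∧ 0 < c₀ ∧ 0 < R₀ ∧ 0 < e₁ ∧
      ∀ i : RegionPairInst d ℓ amin aplus m2plus,
        (regionPairFam F d ℓ amin aplus m2plus creg β (Kmod F hℓ₁ hLip d ℓ hℓ amin aplus m2plus ha) i).regular →
        (regionPairFam F d ℓ amin aplus m2plus creg β (Kmod F hℓ₁ hLip d ℓ hℓ amin aplus m2plus ha) i).bigBlocks →
        0 < i.e → i.e ≤ e₁ →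
        ∀ (μ : Fin (d + 1)) (f : ↥(fineDom ((ℓ + 1) ^ i.k) i.Ωc) × ι → ℝ)
          (x x' : ↥(fineDom ((ℓ + 1) ^ i.k) i.Ωc)) (Γ : List (Fin (d + 1) → ℤ)),
          IsLatChain x.1 Γ → pathEnd x.1 Γ = x'.1 → (Γ.length : ℤ) = l1 x.1 x'.1 →
          R₀ ≤ min (i.cdist x) (i.cdist x') →
          i.wt α x x' * siteNorm (F.U (i.κ * pathSum (compField i.Ac) x.1 Γ)
              *ᵥ fld (i.DΩ F μ *ᵥ (i.GΩ F *ᵥ f)) x' - fld (i.DΩ F μ *ᵥ (i.GΩ F *ᵥ f)) x)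
            ≤ c₀ * Real.exp (-(δ₀ * min (i.sdist1 x f) (i.sdist1 x' f))) * supN f ∧
          i.wt α x x' * siteNorm (F.U (i.κ * pathSum (compField i.Ac) x.1 Γ)
              *ᵥ fld (i.DΩ F μ *ᵥ i.deltaV F f) x' - fld (i.DΩ F μ *ᵥ i.deltaV F f) x)
            ≤ c₀ * Real.exp (-(δ₀ * min (i.sdist1 x f) (i.sdist1 x' f)))
              * Real.exp (-(δ₀ * min (i.cdist x) (i.cdist x') + δ₀ * i.bdistS f)) * supN f := by
  intro α hα0 hα1
  obtain ⟨δ₀, c₀, R₀, e₁, hδ₀, hc₀, hR₀, he₁, H⟩ :=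
    thmPrintedNN_regionPairFam F hℓ₁ hLip d ℓ hℓ amin aplus m2plus ha creg β hcreg hβ α hα0 hα1
  refine ⟨δ₀, 2 * c₀, max R₀ 1, e₁, hδ₀, by positivity, lt_max_of_lt_right one_pos, he₁, ?_⟩
  intro i hreg hbig he hle μ f x x' Γ hΓ hend hlen hRg
  obtain ⟨⟨h19, h110⟩, ⟨h112h, h112⟩⟩ := H i hreg hbig he hle
  dsimp only [Ineq19_110, Ineq111_112, regionPairFam] at h19 h110 h112h h112
  have hR1 : (1 : ℝ) ≤ max R₀ 1 := le_max_right _ _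
  have hRx : max R₀ 1 ≤ i.cdist x := hRg.trans (min_le_left _ _)
  have hRx' : max R₀ 1 ≤ i.cdist x' := hRg.trans (min_le_right _ _)
  have hgx : False ∨ R₀ ≤ i.cdist x := Or.inr ((le_max_left _ _).trans hRx)
  have hgx' : False ∨ R₀ ≤ i.cdist x' := Or.inr ((le_max_left _ _).trans hRx')
  have hg2 : False ∨ R₀ ≤ min (i.cdist x) (i.cdist x') := Or.inr ((le_max_left _ _).trans hRg)
  have hS0 : 0 ≤ supN f := supN_nonneg f
  -- the exponentials at `x`, `x′` are below the exponential at the pair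
  have hex : ∀ {a m : ℝ}, m ≤ a → Real.exp (-(δ₀ * a)) ≤ Real.exp (-(δ₀ * m)) := fun {a m} h =>
    Real.exp_le_exp.2 (by nlinarith)
  have hex2 : ∀ {a m : ℝ}, m ≤ a →
      Real.exp (-(δ₀ * a + δ₀ * i.bdistS f)) ≤ Real.exp (-(δ₀ * m + δ₀ * i.bdistS f)) := fun {a m} h =>
    Real.exp_le_exp.2 (by nlinarith)
  refine ⟨?_, ?_⟩
  · -- (1.9) for `G_k(Ω,A)`
    set B : ℝ := c₀ * Real.exp (-(δ₀ * min (i.sdist1 x f) (i.sdist1 x' f))) * supN f with hB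
    have hB0 : 0 ≤ B := by positivity
    have hQ := h19 μ f x x' hg2
    have hvx : siteNorm (fld (i.DΩ F μ *ᵥ (i.GΩ F *ᵥ f)) x) ≤ B :=
      (h110 μ f x hgx).1.trans (mul_le_mul_of_nonneg_right
        (mul_le_mul_of_nonneg_left (hex (min_le_left _ _)) hc₀.le) hS0)
    have hvx' : siteNorm (fld (i.DΩ F μ *ᵥ (i.GΩ F *ᵥ f)) x') ≤ B :=
      (h110 μ f x' hgx').1.trans (mul_le_mul_of_nonneg_right
        (mul_le_mul_of_nonneg_left (hex (min_le_right _ _)) hc₀.le) hS0)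
    have h := core_bound i F hℓ hα0 (i.DΩ F μ *ᵥ (i.GΩ F *ᵥ f)) hΓ hend hlen hR1 hRx hRx' hB0 hQ hvx hvx'
    calc _ ≤ 2 * B := h
      _ = 2 * c₀ * Real.exp (-(δ₀ * min (i.sdist1 x f) (i.sdist1 x' f))) * supN f := by rw [hB]; ring
  · -- (1.9)·(1.12) for `δG_k(Ω,Ω₀,A)`
    set B : ℝ := c₀ * Real.exp (-(δ₀ * min (i.sdist1 x f) (i.sdist1 x' f)))
      * Real.exp (-(δ₀ * min (i.cdist x) (i.cdist x') + δ₀ * i.bdistS f)) * supN f with hB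
    have hB0 : 0 ≤ B := by positivity
    have hQ := h112h μ f x x' hg2
    have hvx : siteNorm (fld (i.DΩ F μ *ᵥ i.deltaV F f) x) ≤ B := by
      refine (h112 μ f x hgx).1.trans ?_
      refine mul_le_mul_of_nonneg_right (mul_le_mul (mul_le_mul_of_nonneg_left (hex (min_le_left _ _)) hc₀.le)
        (hex2 (min_le_left _ _)) (Real.exp_pos _).le (by positivity)) hS0
    have hvx' : siteNorm (fld (i.DΩ F μ *ᵥ i.deltaV F f) x') ≤ B := by
      refine (h112 μ f x' hgx').1.trans ?_
      refine mul_le_mul_of_nonneg_right (mul_le_mul (mul_le_mul_of_nonneg_left (hex (min_le_right _ _)) hc₀.le)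
        (hex2 (min_le_right _ _)) (Real.exp_pos _).le (by positivity)) hS0
    have h := core_bound i F hℓ hα0 (i.DΩ F μ *ᵥ i.deltaV F f) hΓ hend hlen hR1 hRx hRx' hB0 hQ hvx hvx'
    calc _ ≤ 2 * B := h
      _ = 2 * c₀ * Real.exp (-(δ₀ * min (i.sdist1 x f) (i.sdist1 x' f)))
          * Real.exp (-(δ₀ * min (i.cdist x) (i.cdist x') + δ₀ * i.bdistS f)) * supN f := by rw [hB]; ring

end Main

end

end Literature.MathematicalPhysics.QuantumFieldTheory.Balaban1983to89.B4Thm19ShortestContour
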